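import Literature.Computability.AlgebraicComplexity.RazElusiveGeneralRoute
import Literature.Computability.AlgebraicComplexity.RazElusiveGeneralProofs
import Literature.Computability.AlgebraicComplexity.DefinableVNP
import Literature.Computability.Complexity.CircuitComposition
import HarnessLib

/-!
# Raz's Prop. 5.5 from its printed proof: the monomial-description circuit as a named fact, the `VNP` witness proved

Raz (2010), Prop. 5.5 (p. 171) — "if `f = (f₁, …, f_m)` is poly(`n`)-definable then
`f̃ ∈ F[X, Z]` is poly(`n`)-definable", proof: "Similar to the proof of Proposition 3.6" — is
the named fact `Raz2010_prop_5_5` of `RazElusiveGeneralRoute.lean`, one of the three inputs of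
`Raz2010_cor_5_8_of_parts` (with Cor. 5.7 and the `VNP`-completeness of the permanent). The
printed proof of Prop. 3.6 (pp. 160–161) has three steps:

1. "construct a poly(`n`)-size Boolean circuit `C₁` that gets as input the binary representation
   `j̄` and outputs `r` vectors `(c_{a,1}, …, c_{a,n}) ∈ {0,1}ⁿ` such that
   `∏_a ∑_b c_{a,b} z_b = h⁻¹(j)` … Obviously, this can be done in poly(`n`) time, and hence
   such a circuit `C₁` exists";
2. introduce a Boolean variable `u` for every node of `C₁` and the Cook–Levin consistency check
   `C₂(u, j̄) = 1` iff `u` is the correct computation of `C₁` on `j̄`, "translated into an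
   arithmetic formula of polynomial size and degree";
3. `C(z, u, j̄) = C₂(u, j̄) · ∏_a ∑_b u_{a,b} z_b`, so that `∑_u C = h⁻¹(j)`, and finally
   `f̃ = ∑_{j̄} ∑_e D(x, e, j̄) · ∑_u C(z, u, j̄)` with `D` the Def. 1.3 witness of `f`.

This file vendors step 1 — a statement of Boolean circuit complexity only, printed without
proof — as the named fact `Raz2010_monomialCircuits`, and PROVES steps 2–3 on top of the tree's
transcript arithmetisation of `B₂`-circuits (`CircuitArithmetization.lean`: `validPoly`,
`eval_validPoly`; `DefinableVNP.lean`: `bsum`, `boolSum_rename_equiv`; `CircuitComposition.lean`: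
`CktSize`, `GateList.Realizes`):

* `RazDefinable.Datum` — the data at one index `n` (parameters, the Def. 1.3 witness `g` of
  `f`, the realized gate list of `C₁` with its specification); `Datum.G = GP · VP · PP` is the
  summand `D(x, e, j̄) · C₂(u, j̄) · ∏_a ∑_b u_{a,b} z_b` of the last display of p. 161;
* `RazDefinable.Datum.bsum_G : ∑_{(e, j̄, u)} G = f̃` (steps 2–3: the transcript sum
  `RazDefinable.sum_C_validPoly_mul`, the `e`-sum `Datum.sum_aeval_ψ` = Def. 1.3, the
  description `Datum.Pstar_of_lt` / `Pstar_of_ge` = step 1, and the reindexing `j̄ ↔ j < 2^k`);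
* `Datum.complexity_G_le : L(G) ≤ L(g) + 60·|C₁| + r(2n+1) + 2`,
  `Datum.totalDegree_G_le : deg G ≤ deg g + 3·|C₁| + 2r`;
* `Raz2010_prop_5_5_of_monomialCircuits : Raz2010_monomialCircuits → Raz2010_prop_5_5 F`
  over every field `F`.

Consequently `Raz2010_cor_5_8` (Cor. 1.14) and the corrected curve statement
`Raz2010_elusive_curve` rest on: step 1 (`Raz2010_monomialCircuits`, lexicographic unranking of
degree-`r` monomials by poly(`n`)-size circuits), Cor. 5.7 (`Raz2010_cor_5_7`, the universal
circuit-graph lower bound) and Valiant's completeness of the permanent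
(`Literature.Computability.AlgebraicComplexity.isVNPComplete_perPoly`).

## References

* R. Raz, *Elusive functions and lower bounds for arithmetic circuits*, Theory of Computing 6
  (2010) 135–177: Def. 1.3, §3.3 (Prop. 3.6 and its proof, pp. 160–161), §5.3 (Prop. 5.5,
  p. 171).
* P. Bürgisser, *Completeness and Reduction in Algebraic Complexity Theory*, Springer 2000,
  Prop. 2.20 (Valiant's criterion) and its proof (the transcript polynomial).
* L. G. Valiant, *Completeness classes in algebra*, STOC 1979, §4.

## Design notes

* The Boolean block of the witness is the sum type `e ⊕ (j̄ ⊕ u)` (`Datum.BV`); the tree's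
  `boolSum` format (`Fin ℓ'`) is reached at the end by `DefVNP.boolSum_rename_equiv`.
* `C₁` enters as a realized multi-output gate list (`GateList.Realizes`, from `CktSize`); it is
  repackaged as a `Circuit` (`Datum.Q`, designated output irrelevant) only to reuse
  `CircuitArith.validPoly`.
* Below the threshold `n₀` of the eventual hypotheses the family witness is the trivial
  `RazDefinable.padWitness` (finitely many indices, absorbed by `IsPBounded.of_eventually_le`).
-/

noncomputable section

open MvPolynomial

namespace Literature.Computability.AlgebraicComplexity

open Complexity CircuitArith

universe u v

/-! ### Generic lemmas: sums over bit vectors, the transcript sum against a polynomial weight -/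

namespace RazDefinable

variable {F : Type u} [CommRing F]

/-! ### Sums over bit vectors -/

/-- The bits of `i` as a Boolean input vector of length `K`. [folklore] -/
def bitVec (K : ℕ) (i : ℕ) : Fin K → Bool := fun t => i.testBit t

/-- Below `2^K`, a number is determined by its `K` low bits. [folklore] -/
theorem bitVec_injOn {K : ℕ} {i j : ℕ} (hi : i < 2 ^ K) (hj : j < 2 ^ K)
    (h : bitVec K i = bitVec K j) : i = j := by
  refine Nat.eq_of_testBit_eq fun t => ?_
  by_cases ht : t < K
  · exact congrFun h ⟨t, ht⟩
  · have hK : 2 ^ K ≤ 2 ^ t := Nat.pow_le_pow_right (by norm_num) (not_lt.1 ht)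
    rw [Nat.testBit_lt_two_pow (hi.trans_le hK), Nat.testBit_lt_two_pow (hj.trans_le hK)]

/-- `i ↦ bits of i` is a bijection `Fin (2^K) → (Fin K → Bool)`. [folklore] -/
theorem bitVec_bijective (K : ℕ) :
    Function.Bijective fun i : Fin (2 ^ K) => bitVec K (i : ℕ) := by
  rw [Fintype.bijective_iff_injective_and_card]
  refine ⟨fun i j h => Fin.ext (bitVec_injOn i.isLt j.isLt h), ?_⟩
  simp [Fintype.card_bool, Fintype.card_fin]

/-- Summing over Boolean vectors of length `K` is summing over `i < 2^K` through the bits of `i`.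
[folklore] -/
theorem sum_boolVec_eq_sum_fin {M : Type*} [AddCommMonoid M] (K : ℕ) (Φ : (Fin K → Bool) → M) :
    ∑ w : Fin K → Bool, Φ w = ∑ i : Fin (2 ^ K), Φ (bitVec K (i : ℕ)) :=
  (Fintype.sum_bijective (fun i : Fin (2 ^ K) => bitVec K (i : ℕ)) (bitVec_bijective K)
    (fun i : Fin (2 ^ K) => Φ (bitVec K (i : ℕ))) Φ fun _ => rfl).symm

/-- Splitting a sum over assignments of a three-block Boolean variable set. [folklore] -/
theorem sum_assign_sum₃ {M : Type*} [AddCommMonoid M] {α β γ : Type*} [Fintype α] [Fintype β]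
    [Fintype γ] [DecidableEq α] [DecidableEq β] [DecidableEq γ] (Φ : (α ⊕ (β ⊕ γ) → Bool) → M) :
    ∑ E : α ⊕ (β ⊕ γ) → Bool, Φ E =
      ∑ e : α → Bool, ∑ w : β → Bool, ∑ u : γ → Bool, Φ (Sum.elim e (Sum.elim w u)) := by
  symm
  calc ∑ e : α → Bool, ∑ w : β → Bool, ∑ u : γ → Bool, Φ (Sum.elim e (Sum.elim w u))
      = ∑ e : α → Bool, ∑ p : (β → Bool) × (γ → Bool), Φ (Sum.elim e (Sum.elim p.1 p.2)) :=
        Finset.sum_congr rfl fun e _ =>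
          (Fintype.sum_prod_type' (fun (w : β → Bool) (u : γ → Bool) =>
            Φ (Sum.elim e (Sum.elim w u)))).symm
    _ = ∑ q : (α → Bool) × ((β → Bool) × (γ → Bool)), Φ (Sum.elim q.1 (Sum.elim q.2.1 q.2.2)) :=
        (Fintype.sum_prod_type' (fun (e : α → Bool) (p : (β → Bool) × (γ → Bool)) =>
            Φ (Sum.elim e (Sum.elim p.1 p.2)))).symm
    _ = ∑ E : α ⊕ (β ⊕ γ) → Bool, Φ E := by
        refine Fintype.sum_equiv (((Equiv.sumArrowEquivProdArrow α (β ⊕ γ) Bool).trans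
          (Equiv.prodCongr (Equiv.refl _) (Equiv.sumArrowEquivProdArrow β γ Bool))).symm) _ _
          fun q => ?_
        congr 1

/-! ### The transcript sum against a polynomial weight -/

/-- **The transcript sum against a polynomial weight**: for a `B₂`-circuit `Q`, a Boolean input
`b` and any weight `W` with values in a polynomial ring,
`∑_y C(VALID(b, y)) · W(y) = W(true transcript)` (the Cook–Levin/Valiant consistency check:
`VALID(b, ·)` is the indicator of the unique correct computation; Raz 2010, proof of Prop. 3.6,
step 2; Bürgisser 2000, proof of Prop. 2.20). [cite: Raz2010, proof of Prop. 3.6, step 2 (p. 161)] -/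
theorem sum_C_validPoly_mul {ι : Type v} {τ : Type*} (Q : Circuit ι) (hQ : Q.IsOver B2)
    (b : ι → Bool) (W : (Fin Q.size → Bool) → MvPolynomial τ F) :
    ∑ y : Fin Q.size → Bool, C (eval (bpt F b y) (validPoly Q)) * W y =
      W (trueTranscript Q b) := by
  classical
  simp only [eval_validPoly Q hQ b]
  rw [Finset.sum_eq_single (trueTranscript Q b)]
  · rw [decide_eq_true (ofFn_trueTranscript Q b), toK_true, C_1, one_mul]
  · intro y _ hy
    rw [decide_eq_false (fun h => hy ((ofFn_eq_transcript_iff Q b y).1 h)), toK_false, C_0,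
      zero_mul]
  · intro h; exact absurd (Finset.mem_univ _) h

/-- The two wire-value functions of the library agree (`CircuitSemantics.wireVal` and
`CircuitComposition.GateList.wireOf` are the same definition). [folklore] -/
theorem wireVal_eq_wireOf {ι : Type v} (x : ι → Bool) (vs : List Bool) (w : ι ⊕ ℕ) :
    wireVal x vs w = GateList.wireOf x vs w := by
  cases w <;> rfl

/-- At the true transcript, every wire carries its value in the gate list. [folklore] -/
theorem bwval_trueTranscript {ι : Type v} (Q : Circuit ι) (b : ι → Bool) (w : ι ⊕ ℕ) :
    bwval b (trueTranscript Q b) w = GateList.wireOf b (GateList.vals Q.gates b) w := by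
  rw [bwval_eq_wireVal, ofFn_trueTranscript, ← wireVals_eq_transcript, GateList.circuit_wireVals,
    wireVal_eq_wireOf]

/-! ### Complexity and degree of `VALID` -/

/-- `L(VALID) ≤ 60 |Q|`. [cite: Burgisser2000, Prop. 2.20 (g ∈ VP)] -/
theorem complexity_validPoly_le {ι : Type v} (Q : Circuit ι) :
    complexity (validPoly (k := F) Q) ≤ 60 * Q.size := by
  unfold validPoly
  refine (complexity_finset_prod_le _ _).trans ?_
  calc ∑ j : Fin Q.size, complexity (consPoly (k := F) Q j) +
        (Finset.univ : Finset (Fin Q.size)).card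
      ≤ ∑ _j : Fin Q.size, 59 + (Finset.univ : Finset (Fin Q.size)).card := by
        gcongr with j; exact complexity_consPoly_le Q j
    _ = 60 * Q.size := by
        simp only [Finset.sum_const, Finset.card_univ, Fintype.card_fin, smul_eq_mul]; omega

/-- `deg VALID ≤ 3 |Q|`. [cite: Burgisser2000, Prop. 2.20 (g ∈ VP)] -/
theorem totalDegree_validPoly_le {ι : Type v} (Q : Circuit ι) :
    (validPoly (k := F) Q).totalDegree ≤ 3 * Q.size := by
  unfold validPoly
  refine (totalDegree_finsetProd _ _).trans ?_
  calc ∑ j : Fin Q.size, (consPoly (k := F) Q j).totalDegree ≤ ∑ _j : Fin Q.size, 3 :=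
        Finset.sum_le_sum fun j _ => totalDegree_consPoly_le Q j
    _ = 3 * Q.size := by
        simp only [Finset.sum_const, Finset.card_univ, Fintype.card_fin, smul_eq_mul]; omega

/-! ### One-hot rows and monomials -/

/-- A one-hot row selects a variable: `∑_b C[b = h] · z_b = z_h`. [folklore] -/
theorem sum_C_toK_decide_mul_X {n : ℕ} {τ : Type*} (z : Fin n → MvPolynomial τ F) (h : Fin n) :
    ∑ b : Fin n, C (toK F (decide (b = h))) * z b = z h := by
  rw [Finset.sum_eq_single h]
  · rw [decide_eq_true rfl, toK_true, C_1, one_mul]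
  · intro b _ hb; rw [decide_eq_false hb, toK_false, C_0, zero_mul]
  · intro hh; exact absurd (Finset.mem_univ _) hh

/-- A product of variables is the monomial of the sum of their exponent vectors. [folklore] -/
theorem prod_X_eq_monomial {τ : Type*} {r : ℕ} (h : Fin r → τ) :
    ∏ a : Fin r, (X (h a) : MvPolynomial τ F) = monomial (∑ a, Finsupp.single (h a) 1) 1 := by
  rw [monomial_sum_one]; rfl

/-! ### A trivial Boolean-sum witness (used below the threshold `n₀`) -/

/-- `q(X) · ∏_v e_v`: its Boolean sum over `e ∈ {0,1}^B` is `q` (only `e ≡ 1` contributes).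
[folklore] -/
def padWitness {τ : Type*} (q : MvPolynomial τ F) (B : ℕ) : MvPolynomial (τ ⊕ Fin B) F :=
  rename Sum.inl q * ∏ v : Fin B, X (Sum.inr v)

/-- `boolSum (padWitness q B) = q`. [folklore] -/
theorem boolSum_padWitness {τ : Type*} (q : MvPolynomial τ F) (B : ℕ) :
    boolSum (padWitness q B) = q := by
  classical
  unfold boolSum padWitness
  have hterm : ∀ e : Fin B → Bool,
      aeval (Sum.elim X fun j => if e j then (1 : MvPolynomial τ F) else 0)
        (rename Sum.inl q * ∏ v : Fin B, X (Sum.inr v)) =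
        if e = fun _ => true then q else 0 := by
    intro e
    rw [map_mul, map_prod, aeval_rename]
    have h1 : aeval ((Sum.elim X fun j => if e j then (1 : MvPolynomial τ F) else 0) ∘ Sum.inl) q
        = q := by
      have : ((Sum.elim X fun j => if e j then (1 : MvPolynomial τ F) else 0) ∘ Sum.inl) = X := by
        funext i; rfl
      rw [this, aeval_X_left, AlgHom.coe_id, id_eq]
    rw [h1]
    simp only [aeval_X, Sum.elim_inr]
    split_ifs with he
    · subst he; simp
    · obtain ⟨v, hv⟩ : ∃ v, e v = false := by
        by_contra hcon
        push Not at hcon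
        exact he (funext fun v => by simpa using hcon v)
      rw [Finset.prod_eq_zero (Finset.mem_univ v) (by simp [hv]), mul_zero]
  simp only [hterm]
  rw [Finset.sum_ite_eq' Finset.univ (fun _ : Fin B => true) (fun _ => q)]
  simp

end RazDefinable

/-! ### Step 1 of the printed proof of Prop. 3.6 / 5.5 as a named fact -/

/-- **Raz 2010, proof of Prop. 3.6, step 1 (p. 160)**, invoked verbatim by the proof of Prop. 5.5
(p. 171: "Similar to the proof of Proposition 3.6"): "First construct a poly(`n`)-size Boolean
circuit `C₁` that gets as input the binary representation `j̄` [of `j - 1`] and outputs `r`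
vectors `(c_{1,1}, …, c_{1,n}), ⋯, (c_{r,1}, …, c_{r,n}) ∈ {0,1}ⁿ` such that
`∏_{a=1}^{r} ∑_{b=1}^{n} c_{a,b} z_{a,b} = h⁻¹(j)` [sic: `z_{a,b}` is a misprint for `z_b`, the
variables being `Z = {z₁, …, zₙ}` (§3.1)]. That is, on input `j̄`, the circuit `C₁` generates a
"description" of the monomial `h⁻¹(j) ∈ M`. Obviously, this can be done in poly(`n`) time, and
hence such a circuit `C₁` exists." — with the convention stated there "(For `j ∉ [m′]`, we define
`h⁻¹(j) = 0`.)" [`m′ = C(n+r-1, r)` is the number of monomials; in §3 `m = n · m′`, in §5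
`m = m′`; below `m` denotes `C(n+r-1, r)`]. Setting (§3.1, §5.1): `1 ≤ r ≤ n` (`3 ≤ r` in §5),
`C(n+r-1, r)` degree-`r` monomials in `z₁, …, zₙ`, `h : M → [m]` the lexicographic order
(`lexMonomial` is `h⁻¹`, 0-based), `j̄ ∈ {0,1}^{⌈log₂ m⌉}`, all parameters functions of the basic
parameter `n`; §3.1/§5.1 also assume "for simplicity" that `n` is a power of `2`, which is NOT
assumed here (as in `Raz2010_prop_5_5`).
Rendering: Boolean circuits with several output wires are the tree's straight-line
`B₂`-programs (`Literature.Computability.Complexity.CktSize`, `CircuitComposition.lean`); "poly(`n`)-size" is an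
`IsPBounded` size bound along `n` for the given parameter function `r`; the input is the
0-based index `i = j - 1` through its bits `t ↦ testBit i t` (as in `IsPolyDefinableMap`,
Def. 1.3); the displayed identity in `F[z]` is stated combinatorially, which over a field (indeed
over any domain) is equivalent to it: for `i < m` every row `a` is the indicator of a single
position `hot i a` and these positions form the monomial `h⁻¹(i)`; for `m ≤ i < 2^{⌈log₂ m⌉}`
some row vanishes. This is a statement of Boolean circuit complexity only (lexicographic
unranking of multisets by polynomial-size circuits), printed without proof ("Obviously"); steps
2–3 of the printed proof are PROVED below (`Raz2010_prop_5_5_of_monomialCircuits`). Users take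
`(h : Raz2010_monomialCircuits)`.
[cite: Raz2010, proof of Prop. 3.6, step 1 (p. 160); Prop. 5.5 (p. 171)] -/
def Raz2010_monomialCircuits : Prop :=
  ∀ r : ℕ → ℕ, ∃ p : ℕ → ℕ, IsPBounded p ∧ ∀ n : ℕ, 1 ≤ r n → r n ≤ n →
    ∃ (D : (Fin (Nat.clog 2 (Nat.choose (n + r n - 1) (r n))) → Bool) → Fin (r n) × Fin n → Bool)
      (hot : ℕ → Fin (r n) → Fin n),
      CktSize B2 D (p n) ∧
      (∀ (i : ℕ) (hi : i < Nat.choose (n + r n - 1) (r n)),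
        (∀ a b, D (fun t => i.testBit t) (a, b) = decide (b = hot i a)) ∧
          ∑ a, Finsupp.single (hot i a) 1 = lexMonomial n (r n) ⟨i, hi⟩) ∧
      (∀ i : ℕ, Nat.choose (n + r n - 1) (r n) ≤ i →
        i < 2 ^ Nat.clog 2 (Nat.choose (n + r n - 1) (r n)) →
          ∃ a, ∀ b, D (fun t => i.testBit t) (a, b) = false)

/-! ### Steps 2–3 of the printed proof: the `VNP` witness for one index `n` -/

namespace RazDefinable

variable {F : Type u} [CommRing F]

/-- The data of the printed proof at one index `n`: the parameters `n, r, ℓ`, the Def. 1.3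
witness `g` of `f = (f_0, …, f_{m-1})` (`hg`), and the circuit `C₁` of step 1 as a realized
gate list with its specification. [cite: Raz2010, proof of Prop. 3.6 (pp. 160–161)] -/
structure Datum (F : Type u) [CommRing F] where
  /-- number of variables -/
  n : ℕ
  /-- the degree `r` -/
  r : ℕ
  /-- number of `e`-variables of the Def. 1.3 witness -/
  ℓ : ℕ
  hn : 1 ≤ n
  hr : 1 ≤ r
  /-- the Def. 1.3 witness `g(x, e, w)` -/
  g : MvPolynomial ((Fin n ⊕ Fin ℓ) ⊕ Fin (Nat.clog 2 (Nat.choose (n + r - 1) r))) F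
  /-- the polynomial mapping `f : Fⁿ → F^m` -/
  f : Fin (Nat.choose (n + r - 1) r) → MvPolynomial (Fin n) F
  hg : ∀ i : Fin (Nat.choose (n + r - 1) r),
    f i = boolSum (bitSubst (σ := fun n => Fin n) n ℓ (Nat.clog 2 (Nat.choose (n + r - 1) r)) i g)
  /-- the gates of `C₁` -/
  gs : List (Gate (Fin (Nat.clog 2 (Nat.choose (n + r - 1) r))))
  /-- the `r · n` output wires of `C₁` -/
  out : Fin r × Fin n → Fin (Nat.clog 2 (Nat.choose (n + r - 1) r)) ⊕ ℕ
  /-- the Boolean map computed by `C₁` -/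
  D : (Fin (Nat.clog 2 (Nat.choose (n + r - 1) r)) → Bool) → Fin r × Fin n → Bool
  /-- the hot positions -/
  hot : ℕ → Fin r → Fin n
  real : GateList.Realizes B2 gs out D
  spec₁ : ∀ (i : ℕ) (hi : i < Nat.choose (n + r - 1) r),
    (∀ a b, D (fun t => i.testBit t) (a, b) = decide (b = hot i a)) ∧
      ∑ a, Finsupp.single (hot i a) 1 = lexMonomial n r ⟨i, hi⟩
  spec₂ : ∀ i : ℕ, Nat.choose (n + r - 1) r ≤ i → i < 2 ^ Nat.clog 2 (Nat.choose (n + r - 1) r) →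
    ∃ a, ∀ b, D (fun t => i.testBit t) (a, b) = false

namespace Datum

variable (Λ : Datum F)

/-- `m = C(n+r-1, r)`. [cite: Raz2010, §5.1 (p. 168)] -/
abbrev m : ℕ := Nat.choose (Λ.n + Λ.r - 1) Λ.r

/-- `⌈log₂ m⌉`, the number of `w`-bits. [cite: Raz2010, Def. 1.3] -/
abbrev K : ℕ := Nat.clog 2 Λ.m

/-- `C₁` as a (single-output) `Circuit`; the designated output wire plays no role (only the gate
list and its transcript are used). [cite: Raz2010, proof of Prop. 3.6, step 1] -/
def Q : Circuit (Fin Λ.K) where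
  gates := Λ.gs
  output := Λ.out (⟨0, Λ.hr⟩, ⟨0, Λ.hn⟩)
  wf j hj a m ha := Λ.real.wf j _ (List.getElem?_eq_getElem hj) a m ha
  wf_output m hm := Λ.real.outOK _ m hm

/-- `C₁` is a `B₂`-circuit. [folklore] -/
theorem Q_isOver : Λ.Q.IsOver B2 := fun g hg => Λ.real.isOver g hg

/-- The number of gates of `C₁` (Raz's `ℓ` of step 1). [cite: Raz2010, proof of Prop. 3.6, step 1] -/
abbrev L : ℕ := Λ.Q.size

/-- `L` is the length of the gate list. [folklore] -/
theorem L_eq : Λ.L = Λ.gs.length := rfl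

/-- The Boolean variable block: `e` (`ℓ`), `w = j̄` (`K`), and the node variables `u` of `C₁`
(`L`). [cite: Raz2010, proof of Prop. 3.6, step 2] -/
abbrev BV : Type := Fin Λ.ℓ ⊕ (Fin Λ.K ⊕ Fin Λ.L)

/-- The variables `X, Z`. [cite: Raz2010, §5.3] -/
abbrev XZ : Type := Fin Λ.n ⊕ Fin Λ.n

/-- Placing the variables `(x, e, w)` of `g`. [folklore] -/
def ρ₁ : (Fin Λ.n ⊕ Fin Λ.ℓ) ⊕ Fin Λ.K → Λ.XZ ⊕ Λ.BV :=
  Sum.elim (Sum.elim (fun x => Sum.inl (Sum.inl x)) fun j => Sum.inr (Sum.inl j))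
    fun t => Sum.inr (Sum.inr (Sum.inl t))

/-- Placing the variables `(w, u)` of the transcript polynomial. [folklore] -/
def ρ₂ : Fin Λ.K ⊕ Fin Λ.L → Λ.XZ ⊕ Λ.BV := fun v => Sum.inr (Sum.inr v)

/-- `D(x, e, w)` (Raz's circuit `D` for `g`). [cite: Raz2010, proof of Prop. 3.6 (p. 161)] -/
def GP : MvPolynomial (Λ.XZ ⊕ Λ.BV) F := rename Λ.ρ₁ Λ.g

/-- `C₂(u, j̄) = VALID`, the transcript consistency polynomial of `C₁`. [cite: Raz2010, proof of Prop. 3.6, step 2] -/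
def VP : MvPolynomial (Λ.XZ ⊕ Λ.BV) F := rename Λ.ρ₂ (validPoly (k := F) Λ.Q)

/-- `∑_b u_{a,b} z_b`. [cite: Raz2010, proof of Prop. 3.6, step 3] -/
def rowSum (a : Fin Λ.r) : MvPolynomial (Λ.XZ ⊕ Λ.BV) F :=
  ∑ b : Fin Λ.n, rename Λ.ρ₂ (wirePoly (k := F) Λ.L (Λ.out (a, b))) * X (Sum.inl (Sum.inr b))

/-- `∏_a ∑_b u_{a,b} z_b`. [cite: Raz2010, proof of Prop. 3.6, step 3] -/
def PP : MvPolynomial (Λ.XZ ⊕ Λ.BV) F := ∏ a : Fin Λ.r, Λ.rowSum a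

/-- The witness `G = D(x, e, j̄) · C(z, u, j̄)` with `C = C₂(u, j̄) · ∏_a ∑_b u_{a,b} z_b`
(the summand of the last display on p. 161). [cite: Raz2010, proof of Prop. 3.6 (p. 161)] -/
def G : MvPolynomial (Λ.XZ ⊕ Λ.BV) F := Λ.GP * Λ.VP * Λ.PP

/-- `∏_a ∑_b c_{a,b} z_b` for the description `c = C₁(w)`. [cite: Raz2010, proof of Prop. 3.6, step 1] -/
def Pstar (w : Fin Λ.K → Bool) : MvPolynomial Λ.XZ F :=
  ∏ a : Fin Λ.r, ∑ b : Fin Λ.n, C (toK F (Λ.D w (a, b))) * X (Sum.inr b)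

/-- The substitution seen by `g` under a Boolean assignment `(e, w, u)`: it does not depend on
`u`. [folklore] -/
def ψ (e : Fin Λ.ℓ → Bool) (w : Fin Λ.K → Bool) :
    (Fin Λ.n ⊕ Fin Λ.ℓ) ⊕ Fin Λ.K → MvPolynomial Λ.XZ F :=
  Sum.elim (Sum.elim (fun x => X (Sum.inl x)) fun j => C (toK F (e j))) fun t => C (toK F (w t))

section Eval

variable (e : Fin Λ.ℓ → Bool) (w : Fin Λ.K → Bool) (u : Fin Λ.L → Bool)

/-- Scalar gadgets in `(w, u)` become constants under the Boolean substitution. [folklore] -/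
theorem aeval_φb_rename_ρ₂ (p : MvPolynomial (Fin Λ.K ⊕ Fin Λ.L) F) :
    aeval (DefVNP.φb (k := F) (σ := Λ.XZ) (Sum.elim e (Sum.elim w u))) (rename Λ.ρ₂ p) =
      C (eval (bpt F w u) p) := by
  have h : rename Λ.ρ₂ p = rename Sum.inr (rename Sum.inr p) := by
    rw [rename_rename]; rfl
  have hpt : (toK F ∘ Sum.elim e (Sum.elim w u)) ∘ Sum.inr = bpt F w u := by
    funext v
    rcases v with t | j <;> rfl
  rw [h, DefVNP.aeval_φb_rename_inr, eval_rename, hpt]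

/-- `VP` becomes the transcript indicator `[u = transcript of C₁ on w]`. [cite: Raz2010, proof of Prop. 3.6, step 2] -/
theorem aeval_VP : aeval (DefVNP.φb (k := F) (σ := Λ.XZ) (Sum.elim e (Sum.elim w u))) Λ.VP =
    C (eval (bpt F w u) (validPoly (k := F) Λ.Q)) :=
  Λ.aeval_φb_rename_ρ₂ e w u _

/-- `PP` becomes `∏_a ∑_b [u_{out(a,b)}] z_b`. [cite: Raz2010, proof of Prop. 3.6, step 3] -/
theorem aeval_PP : aeval (DefVNP.φb (k := F) (σ := Λ.XZ) (Sum.elim e (Sum.elim w u))) Λ.PP =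
    ∏ a : Fin Λ.r, ∑ b : Fin Λ.n, C (toK F (bwval w u (Λ.out (a, b)))) * X (Sum.inr b) := by
  unfold PP
  rw [map_prod]
  refine Finset.prod_congr rfl fun a _ => ?_
  unfold rowSum
  rw [map_sum]
  refine Finset.sum_congr rfl fun b _ => ?_
  rw [map_mul, aeval_φb_rename_ρ₂, eval_wirePoly, aeval_X]
  rfl

/-- `GP` becomes `g` under the substitution `ψ e w`. [folklore] -/
theorem aeval_GP : aeval (DefVNP.φb (k := F) (σ := Λ.XZ) (Sum.elim e (Sum.elim w u))) Λ.GP =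
    aeval (Λ.ψ e w) Λ.g := by
  have hψ : (DefVNP.φb (k := F) (σ := Λ.XZ) (Sum.elim e (Sum.elim w u))) ∘ Λ.ρ₁ = Λ.ψ e w := by
    funext v
    rcases v with (x | j) | t <;> rfl
  unfold GP
  rw [aeval_rename, hψ]

end Eval

/-- For `i < m`, the description of `h⁻¹(i)` gives the monomial:
`∏_a ∑_b c_{a,b} z_b = h⁻¹(i)`. [cite: Raz2010, proof of Prop. 3.6, step 1] -/
theorem Pstar_of_lt (i : ℕ) (hi : i < Λ.m) :
    Λ.Pstar (fun t => i.testBit t) = rename Sum.inr (monomial (lexMonomial Λ.n Λ.r ⟨i, hi⟩) 1) := by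
  obtain ⟨hrow, hsum⟩ := Λ.spec₁ i hi
  unfold Pstar
  calc ∏ a : Fin Λ.r, ∑ b : Fin Λ.n, C (toK F (Λ.D (fun t => i.testBit t) (a, b))) * X (Sum.inr b)
      = ∏ a : Fin Λ.r, (X (Sum.inr (Λ.hot i a)) : MvPolynomial Λ.XZ F) := by
        refine Finset.prod_congr rfl fun a _ => ?_
        simp only [hrow]
        exact sum_C_toK_decide_mul_X (fun b => (X (Sum.inr b) : MvPolynomial Λ.XZ F)) (Λ.hot i a)
    _ = rename Sum.inr (∏ a : Fin Λ.r, (X (Λ.hot i a) : MvPolynomial (Fin Λ.n) F)) := by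
        rw [map_prod]
        simp only [rename_X]
    _ = rename Sum.inr (monomial (lexMonomial Λ.n Λ.r ⟨i, hi⟩) 1) := by
        rw [prod_X_eq_monomial, hsum]

/-- For `m ≤ i < 2^K`, some row of the description vanishes, so the product is `0`
("for `j ∉ [m]`, `h⁻¹(j) = 0`"). [cite: Raz2010, proof of Prop. 3.6, step 1] -/
theorem Pstar_of_ge (i : ℕ) (hmi : Λ.m ≤ i) (hi : i < 2 ^ Λ.K) :
    Λ.Pstar (fun t => i.testBit t) = 0 := by
  obtain ⟨a, ha⟩ := Λ.spec₂ i hmi hi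
  unfold Pstar
  refine Finset.prod_eq_zero (Finset.mem_univ a) (Finset.sum_eq_zero fun b _ => ?_)
  rw [ha b, toK_false, C_0, zero_mul]

/-- The `e`-sum of `g` under `ψ e (bits i)` is `f_i` (Def. 1.3), placed in the `X`-variables.
[cite: Raz2010, Def. 1.3; proof of Prop. 3.6 (p. 161)] -/
theorem sum_aeval_ψ (i : ℕ) (hi : i < Λ.m) :
    ∑ e : Fin Λ.ℓ → Bool, aeval (Λ.ψ e fun t => i.testBit t) Λ.g = rename Sum.inl (Λ.f ⟨i, hi⟩) := by
  rw [Λ.hg ⟨i, hi⟩]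
  unfold boolSum
  rw [map_sum]
  refine Finset.sum_congr rfl fun e _ => ?_
  unfold bitSubst
  rw [← AlgHom.comp_apply, ← AlgHom.comp_apply, comp_aeval, comp_aeval]
  congr 1
  refine congrArg _ (funext fun v => ?_)
  rcases v with (x | j) | t
  · simp [ψ]
  · simp only [ψ, Sum.elim_inl, Sum.elim_inr, aeval_X]
    cases e j <;> simp [toK]
  · simp only [ψ, Sum.elim_inr]
    cases i.testBit t <;> simp [toK]

/-- **Steps 2–3 of the printed proof**: the Boolean sum of `G` over `(e, w, u)` is `f̃`:
`∑_{j̄} ∑_e D(x, e, j̄) · ∑_u C(z, u, j̄) = ∑_{j ∈ [m]} f_j(x) · h⁻¹(j) = f̃(x, z)`.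
[cite: Raz2010, proof of Prop. 3.6 (p. 161); Prop. 5.5 (p. 171)] -/
theorem bsum_G : DefVNP.bsum Λ.G = razTilde Λ.f := by
  classical
  unfold DefVNP.bsum
  rw [sum_assign_sum₃]
  -- each summand, with the `u`-independent factors separated
  have hterm : ∀ (e : Fin Λ.ℓ → Bool) (w : Fin Λ.K → Bool) (u : Fin Λ.L → Bool),
      aeval (DefVNP.φb (k := F) (σ := Λ.XZ) (Sum.elim e (Sum.elim w u))) Λ.G =
        C (eval (bpt F w u) (validPoly (k := F) Λ.Q)) * (aeval (Λ.ψ e w) Λ.g *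
          ∏ a : Fin Λ.r, ∑ b : Fin Λ.n, C (toK F (bwval w u (Λ.out (a, b)))) * X (Sum.inr b)) := by
    intro e w u
    unfold G
    rw [map_mul, map_mul, aeval_GP, aeval_VP, aeval_PP]
    ring
  simp only [hterm]
  -- step 2: the transcript sum over `u` collapses to the true computation of `C₁` on `w`
  have hu : ∀ (e : Fin Λ.ℓ → Bool) (w : Fin Λ.K → Bool),
      ∑ u : Fin Λ.L → Bool, C (eval (bpt F w u) (validPoly (k := F) Λ.Q)) * (aeval (Λ.ψ e w) Λ.g *
          ∏ a : Fin Λ.r, ∑ b : Fin Λ.n, C (toK F (bwval w u (Λ.out (a, b)))) * X (Sum.inr b)) =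
        aeval (Λ.ψ e w) Λ.g * Λ.Pstar w := by
    intro e w
    rw [sum_C_validPoly_mul Λ.Q Λ.Q_isOver w fun u => aeval (Λ.ψ e w) Λ.g *
      ∏ a : Fin Λ.r, ∑ b : Fin Λ.n, C (toK F (bwval w u (Λ.out (a, b)))) * X (Sum.inr b)]
    unfold Pstar
    congr 1
    refine Finset.prod_congr rfl fun a _ => Finset.sum_congr rfl fun b _ => ?_
    rw [bwval_trueTranscript]
    congr 3
    exact Λ.real.eval w (a, b)
  simp only [hu]
  -- step 3: reorder, factor, and reindex `w = bits i`, `i < 2^K`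
  rw [Finset.sum_comm]
  simp only [← Finset.sum_mul]
  rw [sum_boolVec_eq_sum_fin]
  have hm : Λ.m ≤ 2 ^ Λ.K := Nat.le_pow_clog one_lt_two _
  set T : ℕ → MvPolynomial Λ.XZ F := fun i =>
    (∑ e : Fin Λ.ℓ → Bool, aeval (Λ.ψ e fun t => i.testBit t) Λ.g) * Λ.Pstar fun t => i.testBit t
    with hT
  have h1 : ∑ i : Fin (2 ^ Λ.K), (∑ e : Fin Λ.ℓ → Bool, aeval (Λ.ψ e (bitVec Λ.K (i : ℕ))) Λ.g) *
      Λ.Pstar (bitVec Λ.K (i : ℕ)) = ∑ i ∈ Finset.range (2 ^ Λ.K), T i :=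
    Fin.sum_univ_eq_sum_range T (2 ^ Λ.K)
  have h2 : ∑ i ∈ Finset.range Λ.m, T i = ∑ i ∈ Finset.range (2 ^ Λ.K), T i := by
    refine Finset.sum_subset (Finset.range_subset_range.2 hm) fun i hi hin => ?_
    rw [Finset.mem_range] at hi hin
    rw [hT]
    dsimp only
    rw [Λ.Pstar_of_ge i (not_lt.1 hin) hi, mul_zero]
  rw [h1, ← h2, ← Fin.sum_univ_eq_sum_range T Λ.m]
  unfold razTilde
  refine Finset.sum_congr rfl fun j _ => ?_
  rw [hT]
  dsimp only
  rw [Λ.sum_aeval_ψ j j.isLt, Λ.Pstar_of_lt j j.isLt]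

/-! ### Size and degree of the witness -/

/-- `L(G) ≤ L(g) + 60 L + r (2n + 1) + 2`. [cite: Raz2010, proof of Prop. 3.6 ("size poly(n)")] -/
theorem complexity_G_le :
    complexity Λ.G ≤ complexity Λ.g + 60 * Λ.L + Λ.r * (2 * Λ.n + 1) + 2 := by
  have h1 : complexity Λ.GP ≤ complexity Λ.g := complexity_rename_le_holds' _ _
  have h2 : complexity Λ.VP ≤ 60 * Λ.L :=
    (complexity_rename_le_holds' _ _).trans (complexity_validPoly_le Λ.Q)
  have hrow : ∀ a, complexity (Λ.rowSum a) ≤ 2 * Λ.n := fun a => by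
    unfold rowSum
    refine (complexity_finset_sum_le _ _).trans ?_
    have hb : ∀ b : Fin Λ.n, complexity (rename Λ.ρ₂ (wirePoly (k := F) Λ.L (Λ.out (a, b))) *
        X (Sum.inl (Sum.inr b)) : MvPolynomial (Λ.XZ ⊕ Λ.BV) F) ≤ 1 := fun b => by
      refine (complexity_mul_le_holds _ _).trans ?_
      have hX : complexity (X (Sum.inl (Sum.inr b)) : MvPolynomial (Λ.XZ ⊕ Λ.BV) F) = 0 :=
        complexity_X_holds _
      have hW : complexity (rename Λ.ρ₂ (wirePoly (k := F) Λ.L (Λ.out (a, b)))) ≤ 0 :=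
        (complexity_rename_le_holds' _ _).trans_eq (complexity_wirePoly _)
      omega
    calc ∑ b : Fin Λ.n, complexity (rename Λ.ρ₂ (wirePoly (k := F) Λ.L (Λ.out (a, b))) *
            X (Sum.inl (Sum.inr b)) : MvPolynomial (Λ.XZ ⊕ Λ.BV) F) +
          (Finset.univ : Finset (Fin Λ.n)).card
        ≤ ∑ _b : Fin Λ.n, 1 + (Finset.univ : Finset (Fin Λ.n)).card := by
          gcongr with b; exact hb b
      _ = 2 * Λ.n := by
          simp only [Finset.sum_const, Finset.card_univ, Fintype.card_fin, smul_eq_mul]; omega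
  have h3 : complexity Λ.PP ≤ Λ.r * (2 * Λ.n + 1) := by
    unfold PP
    refine (complexity_finset_prod_le _ _).trans ?_
    calc ∑ a : Fin Λ.r, complexity (Λ.rowSum a) + (Finset.univ : Finset (Fin Λ.r)).card
        ≤ ∑ _a : Fin Λ.r, 2 * Λ.n + (Finset.univ : Finset (Fin Λ.r)).card := by
          gcongr with a; exact hrow a
      _ = Λ.r * (2 * Λ.n + 1) := by
          simp only [Finset.sum_const, Finset.card_univ, Fintype.card_fin, smul_eq_mul]; ring
  unfold G
  calc complexity (Λ.GP * Λ.VP * Λ.PP) ≤ complexity (Λ.GP * Λ.VP) + complexity Λ.PP + 1 :=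
        complexity_mul_le_holds _ _
    _ ≤ (complexity Λ.GP + complexity Λ.VP + 1) + complexity Λ.PP + 1 := by
        gcongr; exact complexity_mul_le_holds _ _
    _ ≤ _ := by omega

/-- `deg G ≤ deg g + 3 L + 2 r`. [cite: Raz2010, proof of Prop. 3.6 ("degree poly(n)")] -/
theorem totalDegree_G_le : (Λ.G).totalDegree ≤ (Λ.g).totalDegree + 3 * Λ.L + 2 * Λ.r := by
  have h1 : (Λ.GP).totalDegree ≤ (Λ.g).totalDegree := totalDegree_rename_le _ _
  have h2 : (Λ.VP).totalDegree ≤ 3 * Λ.L :=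
    (totalDegree_rename_le _ _).trans (totalDegree_validPoly_le Λ.Q)
  have hrow : ∀ a, (Λ.rowSum a).totalDegree ≤ 2 := fun a => by
    unfold rowSum
    refine totalDegree_finsetSum_le fun b _ => ?_
    refine (totalDegree_mul _ _).trans ?_
    have hW : (rename Λ.ρ₂ (wirePoly (k := F) Λ.L (Λ.out (a, b)))).totalDegree ≤ 1 :=
      (totalDegree_rename_le _ _).trans (totalDegree_wirePoly_le _)
    have hX : (X (Sum.inl (Sum.inr b)) : MvPolynomial (Λ.XZ ⊕ Λ.BV) F).totalDegree ≤ 1 :=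
      totalDegree_X_le_one' (k := F) _
    omega
  have h3 : (Λ.PP).totalDegree ≤ 2 * Λ.r := by
    unfold PP
    refine (totalDegree_finsetProd _ _).trans ?_
    calc ∑ a : Fin Λ.r, (Λ.rowSum a).totalDegree ≤ ∑ _a : Fin Λ.r, 2 :=
          Finset.sum_le_sum fun a _ => hrow a
      _ = 2 * Λ.r := by
          simp only [Finset.sum_const, Finset.card_univ, Fintype.card_fin, smul_eq_mul]; ring
  unfold G
  calc (Λ.GP * Λ.VP * Λ.PP).totalDegree ≤ (Λ.GP * Λ.VP).totalDegree + (Λ.PP).totalDegree :=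
        totalDegree_mul _ _
    _ ≤ ((Λ.GP).totalDegree + (Λ.VP).totalDegree) + (Λ.PP).totalDegree := by
        gcongr; exact totalDegree_mul _ _
    _ ≤ _ := by omega

/-! ### The witness in the tree's `boolSum` format -/

/-- Enumerating the Boolean block. [folklore] -/
def ε : Λ.BV ≃ Fin (Λ.ℓ + (Λ.K + Λ.L)) :=
  (Equiv.sumCongr (Equiv.refl _) finSumFinEquiv).trans finSumFinEquiv

/-- The witness with its Boolean variables enumerated. [cite: Raz2010, proof of Prop. 3.6 (p. 161)] -/
def gFin : MvPolynomial (Λ.XZ ⊕ Fin (Λ.ℓ + (Λ.K + Λ.L))) F := rename (Sum.map id Λ.ε) Λ.G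

/-- `∑_e gFin = f̃`. [cite: Raz2010, proof of Prop. 3.6 (p. 161); Prop. 5.5] -/
theorem boolSum_gFin : boolSum Λ.gFin = razTilde Λ.f := by
  rw [gFin, DefVNP.boolSum_rename_equiv, bsum_G]

/-- Size of the enumerated witness. [folklore] -/
theorem complexity_gFin_le :
    complexity Λ.gFin ≤ complexity Λ.g + 60 * Λ.L + Λ.r * (2 * Λ.n + 1) + 2 :=
  (complexity_rename_le_holds' _ _).trans Λ.complexity_G_le

/-- Degree of the enumerated witness. [folklore] -/
theorem totalDegree_gFin_le : (Λ.gFin).totalDegree ≤ (Λ.g).totalDegree + 3 * Λ.L + 2 * Λ.r :=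
  (totalDegree_rename_le _ _).trans Λ.totalDegree_G_le

end Datum

end RazDefinable

/-! ### Prop. 5.5 from step 1 of its printed proof -/

/-- A polynomial bound used thrice. [folklore] -/
private theorem isPBounded_lin_quad {a b : ℕ → ℕ} (ha : IsPBounded a) (hb : IsPBounded b)
    (c₁ c₂ c₃ c₄ : ℕ) :
    IsPBounded fun n => a n + c₁ * b n + c₂ * (n * (c₃ * n + 1)) + c₄ * n + 2 := by
  refine IsPBounded.add_holds (IsPBounded.add_holds (IsPBounded.add_holds (IsPBounded.add_holds
    ha (IsPBounded.mul_holds (IsPBounded.const c₁) hb)) (IsPBounded.mul_holds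
    (IsPBounded.const c₂) (IsPBounded.mul_holds IsPBounded.id (IsPBounded.add_holds
    (IsPBounded.mul_holds (IsPBounded.const c₃) IsPBounded.id) (IsPBounded.const 1)))))
    (IsPBounded.mul_holds (IsPBounded.const c₄) IsPBounded.id)) (IsPBounded.const 2)

/-- **Raz 2010, Prop. 5.5, from step 1 of its printed proof.** Given the monomial-description
circuits `C₁` of step 1 (`Raz2010_monomialCircuits`, printed without proof), Prop. 5.5
(`Raz2010_prop_5_5`: `f` poly(`n`)-definable ⇒ `f̃` poly(`n`)-definable) holds over every field,
by steps 2–3 of the printed proof (pp. 160–161, "Similar to the proof of Proposition 3.6",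
p. 171): with `D(x, e, j̄)` the Def. 1.3 witness of `f` and `C(z, u, j̄) = C₂(u, j̄) ·
∏_a ∑_b u_{a,b} z_b`, where `C₂ = VALID` is the Cook–Levin transcript check of `C₁` (the
tree's `CircuitArith.validPoly`), the polynomial `G = D · C` has polynomially bounded size and
degree (`RazDefinable.Datum.complexity_G_le`, `totalDegree_G_le`) and
`∑_{j̄, e, u} G = ∑_{j ∈ [m]} f_j(x) · h⁻¹(j) = f̃` (`RazDefinable.Datum.bsum_G`). Indices `n`
below the threshold of the hypotheses use a trivial witness (finitely many, absorbed by
`IsPBounded`). Hence `Raz2010_cor_5_8` (and the corrected curve statement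
`Raz2010_elusive_curve`) follow from `Raz2010_monomialCircuits`, `Raz2010_cor_5_7` and the
`VNP`-completeness of the permanent (`Raz2010_cor_5_8_of_parts`).
[cite: Raz2010, Prop. 5.5 (p. 171); proof of Prop. 3.6 (pp. 160–161)] -/
theorem Raz2010_prop_5_5_of_monomialCircuits {F : Type u} [Field F]
    (hMC : Raz2010_monomialCircuits) : Raz2010_prop_5_5 F := by
  intro r f hpar hdef
  obtain ⟨ℓ, g, hℓ, hgdeg, hgcx, hg⟩ := hdef
  obtain ⟨p, hp, hC⟩ := hMC r
  obtain ⟨n₀, hpar⟩ := hpar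
  have hK : ∀ n, n₀ ≤ n → Nat.clog 2 (Nat.choose (n + r n - 1) (r n)) ≤ 2 * n := by
    intro n hn
    obtain ⟨-, hrn⟩ := hpar n hn
    refine Nat.clog_le_of_le_pow ((Nat.choose_le_two_pow _ _).trans ?_)
    exact Nat.pow_le_pow_right (by norm_num) (by omega)
  -- the witness at each index `n`
  have key : ∀ n, ∃ (L : ℕ) (G : MvPolynomial ((Fin n ⊕ Fin n) ⊕
      Fin (ℓ n + (Nat.clog 2 (Nat.choose (n + r n - 1) (r n)) + L))) F),
      boolSum G = razTilde (n := n) (r := r n) (f n) ∧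
        (n₀ ≤ n → L ≤ p n ∧
          complexity G ≤ complexity (g n) + 60 * p n + n * (2 * n + 1) + 2 ∧
          G.totalDegree ≤ (g n).totalDegree + 3 * p n + 2 * n) := by
    intro n
    by_cases hn : n₀ ≤ n
    · obtain ⟨h3, hrn⟩ := hpar n hn
      obtain ⟨D, hot, hsz, hspec₁, hspec₂⟩ := hC n (by omega) hrn
      obtain ⟨gs, out, hlen, hreal⟩ := hsz
      let Λ : RazDefinable.Datum F :=
        { n := n, r := r n, ℓ := ℓ n, hn := by omega, hr := by omega, g := g n, f := f n,
          hg := hg n, gs := gs, out := out, D := D, hot := hot, real := hreal,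
          spec₁ := hspec₁, spec₂ := hspec₂ }
      refine ⟨gs.length, Λ.gFin, Λ.boolSum_gFin, fun _ => ⟨hlen, ?_, ?_⟩⟩
      · calc complexity Λ.gFin ≤ complexity (g n) + 60 * gs.length + r n * (2 * n + 1) + 2 :=
            Λ.complexity_gFin_le
          _ ≤ complexity (g n) + 60 * p n + n * (2 * n + 1) + 2 := by
            have : r n * (2 * n + 1) ≤ n * (2 * n + 1) := Nat.mul_le_mul_right _ hrn
            omega
      · calc (Λ.gFin).totalDegree ≤ (g n).totalDegree + 3 * gs.length + 2 * r n :=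
            Λ.totalDegree_gFin_le
          _ ≤ (g n).totalDegree + 3 * p n + 2 * n := by omega
    · exact ⟨0, RazDefinable.padWitness (razTilde (n := n) (r := r n) (f n)) _,
        RazDefinable.boolSum_padWitness _ _, fun h => absurd h hn⟩
  choose L G hG using key
  refine ⟨fun n => ℓ n + (Nat.clog 2 (Nat.choose (n + r n - 1) (r n)) + L n), G, ?_, ?_, ?_,
    fun n => (hG n).1.symm⟩
  · refine IsPBounded.of_eventually_le n₀ (isPBounded_lin_quad hℓ hp 1 0 0 2) fun n hn => ?_
    have h1 := hK n hn
    have h2 := ((hG n).2 hn).1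
    omega
  · refine IsPBounded.of_eventually_le n₀ (isPBounded_lin_quad hgdeg hp 3 0 0 2) fun n hn => ?_
    have h2 := ((hG n).2 hn).2.2
    omega
  · refine IsPBounded.of_eventually_le n₀ (isPBounded_lin_quad hgcx hp 60 1 2 0) fun n hn => ?_
    have h2 := ((hG n).2 hn).2.1
    omega

/-- **The corrected curve statement from step 1, Cor. 5.7 and Valiant's completeness.**
Composition of `Raz2010_prop_5_5_of_monomialCircuits`, `Raz2010_cor_5_8_of_parts`
(`RazElusiveGeneralRoute.lean`) and `Raz2010_elusive_curve_of_cor_5_8`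
(`RazElusiveGeneralProofs.lean`): the faithful form `Raz2010_elusive_curve` of Raz's headline
result for curves rests on the three named facts `Raz2010_monomialCircuits`, `Raz2010_cor_5_7`,
`Literature.Computability.AlgebraicComplexity.isVNPComplete_perPoly`. [cite: Raz2010, Cor. 5.8 (p. 172); abstract] -/
theorem Raz2010_elusive_curve_of_monomialCircuits {F : Type u} [Field F]
    (hMC : Raz2010_monomialCircuits) (h57 : Raz2010_cor_5_7 F)
    (hV : Literature.Computability.AlgebraicComplexity.isVNPComplete_perPoly F) : Raz2010_elusive_curve F :=
  Raz2010_elusive_curve_of_cor_5_8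
    (Raz2010_cor_5_8_of_parts (Raz2010_prop_5_5_of_monomialCircuits hMC) h57 hV)

end Literature.Computability.AlgebraicComplexity

end
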